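import Summits.RiemannHypothesis.RiemannHypothesis.Theorems.EarlyAppointmentsRemainder0XiFarAbelSkeleton
import Summits.RiemannHypothesis.RiemannHypothesis.Theorems.Splittings.EarlyAppointmentsXiWindowCounts

/-!
# ⟨24730⟩ ρ2 v4 — LEAF 3 of `stub_farAbel4` CLOSED: the near mirror partners, `‖Σ_near ord_u/(w+u)‖ ≤ 10⁻⁶`

C4 «kernel desk» rh-idea-6 g30, director (CA406)(c).  SUPPORT module for crux r3 `Remainder0Xi` of route
`EarlyAppointments` (line rho2_v4), fully proved, standard axioms, imports = the skeleton pre-image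
`…EarlyAppointmentsRemainder0XiFarAbelSkeleton` (C4 g30, 2ac71bb0) + tree `…Splittings.EarlyAppointmentsXiWindowCounts`.

The skeleton's LEAF 3 is `NearPartnerLeaf K : ∀ γ > T_PT, ∀ w, |Re w − γ| ≤ 67.5 → |Im w| ≤ 1/2 → ‖nearPartnerSum w‖ ≤ K.cN`
with `nearPartnerSum w = Σᶠ_{Ξ u = 0, |Re u − Re w| < 67.5} ord_u · (w + u)⁻¹` (the mirror partners `−u` of the near zeros, which
the registered `farField` keeps but MAIN does not see).  Proof: each term has `‖(w+u)⁻¹‖ ≤ 1/(Re w + Re u) ≤ 1/(2 Re w − 67.5)`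
(A); the multiplicity count of the near window is `≤ N(Re w + 68) − N(Re w − 68)` by the landed Ξ ↔ ζ dictionary
(`XiDictColumn`, ε = 1/2) and `≤ 136/s(Re w) + 2·W₁(2 Re w) + 1/100` by the landed HSW column bound `column_count_le_TB` (B);
and `(23·log(2x) + 10)/(2x − 67.5) ≤ 10⁻⁶` for `x ≥ T_PT − 67.5` via `log y ≤ 4·y^{1/4}` (C).  Hence
`nearPartnerLeaf_of (K) (hK : 1/10^6 ≤ K.cN) : NearPartnerLeaf K` — in particular for C3 g41's table `K4N`
(`cN = 10⁻⁶`, `LedgerLeaf4 K4N` proved in `LedgerLeaf4-C3-g41.lean`).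
Nothing here bears on the truth of RH; RH is not proved; 24730 OPEN.
-/

namespace Summit.RiemannHypothesis.RiemannHypothesis.Theorems.EarlyAppointmentsRemainder0Xi.NearPartnerLeaf

open Complex Set Real
open Literature.NumberTheory.LFunctions
open Summit.RiemannHypothesis.RiemannHypothesis.Cruxes.Remainder0Xi.Rho2V2 (T_PT boxHalfWidth eta0)
open Summit.RiemannHypothesis.RiemannHypothesis.Theorems.Splittings.EarlyAppointmentsXiZetaDictionary
  (xiOrd xiOrd_nonneg finsum_mem_mono_set xiDict_of_halfOpen xiDictHalfOpen_holds xiZerosWindowFinite_holds)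
open Summit.RiemannHypothesis.RiemannHypothesis.Theorems.Splittings.EarlyAppointmentsXiWindowCounts
  (W₁ column_count_le_TB div_xiSpacing)
open Summit.RiemannHypothesis.RiemannHypothesis.Theorems.EarlyAppointmentsRemainder0Xi.FarFieldReindex
  (nearWin nearWin_finite)
open Summit.RiemannHypothesis.RiemannHypothesis.Theorems.EarlyAppointmentsRemainder0Xi.FarAbelSkeleton
  (nearPartnerSum LeafConsts NearPartnerLeaf)

/-- (A) termwise: a near zero `u` has `Re u > Re w − 67.5`, so `‖n · (w+u)⁻¹‖ ≤ n / (2 Re w − 67.5)` once `Re w > 67.5`. -/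
theorem norm_term_le {w u : ℂ} (hre : boxHalfWidth < w.re) (hu : u ∈ nearWin w) (n : ℕ) :
    ‖(n : ℂ) * (w + u)⁻¹‖ ≤ (n : ℝ) / (2 * w.re - boxHalfWidth) := by
  have h1 := (abs_lt.1 hu.2).1
  have hB : (0 : ℝ) ≤ boxHalfWidth := by norm_num [boxHalfWidth]
  have hD : 0 < 2 * w.re - boxHalfWidth := by linarith
  have hre_sum : 2 * w.re - boxHalfWidth ≤ (w + u).re := by
    rw [Complex.add_re]; linarith
  have hnorm : 2 * w.re - boxHalfWidth ≤ ‖w + u‖ := hre_sum.trans (Complex.re_le_norm _)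
  rw [norm_mul, norm_inv, Complex.norm_natCast, div_eq_mul_inv]
  exact mul_le_mul_of_nonneg_left (inv_anti₀ hD hnorm) (Nat.cast_nonneg n)

/-- (A′) the near-partner sum is bounded by the multiplicity COUNT of the near window over `2 Re w − 67.5`. -/
theorem norm_nearPartnerSum_le_count {w : ℂ} (hre : boxHalfWidth < w.re) :
    ‖nearPartnerSum w‖ ≤ (∑ᶠ u ∈ nearWin w, xiOrd u) / (2 * w.re - boxHalfWidth) := by
  have hfin := nearWin_finite w
  have e : nearPartnerSum w = ∑ᶠ u ∈ nearWin w, ((analyticOrderAt riemannXiUpper u).toNat : ℂ) * (w + u)⁻¹ := rfl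
  rw [e, finsum_mem_eq_finite_toFinset_sum _ hfin, finsum_mem_eq_finite_toFinset_sum _ hfin, Finset.sum_div]
  refine (norm_sum_le _ _).trans (Finset.sum_le_sum fun u hu ↦ ?_)
  exact norm_term_le hre (hfin.mem_toFinset.1 hu) _

/-- (B) the COUNT of the near window: dictionary (`XiDictColumn`, ε = 1/2) + HSW column bound (`column_count_le_TB`, r = 68):
`Σ_near ord_u ≤ (136/2π)·log(Re w/2π) + 2·W₁(2 Re w) + 1/100` for `Re w ≥ 3.0610046·10¹⁰ + 68`. -/
theorem count_le {w : ℂ} (hx : 30610046068 ≤ w.re) :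
    ∑ᶠ u ∈ nearWin w, xiOrd u ≤
      2 * 68 / (2 * π) * Real.log (w.re / (2 * π)) + 2 * W₁ (2 * w.re) + 1 / 100 := by
  have hB : boxHalfWidth = 135 / 2 := rfl
  have hsub : nearWin w ⊆ {u : ℂ | riemannXiUpper u = 0 ∧ |u.re - w.re| ≤ boxHalfWidth} :=
    fun u hu ↦ ⟨hu.1, hu.2.le⟩
  have hfin : {u : ℂ | riemannXiUpper u = 0 ∧ |u.re - w.re| ≤ boxHalfWidth}.Finite := by
    refine (xiZerosWindowFinite_holds (w.re - boxHalfWidth) (w.re + boxHalfWidth)).subset ?_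
    intro u hu
    have h := abs_le.1 hu.2
    exact ⟨hu.1, by linarith [h.1], by linarith [h.2]⟩
  have h1 := finsum_mem_mono_set hsub hfin xiOrd_nonneg
  have hcol := (xiDict_of_halfOpen xiDictHalfOpen_holds xiZerosWindowFinite_holds).1 w.re boxHalfWidth (1 / 2)
    (by rw [hB]; norm_num) (by norm_num) (by rw [hB]; linarith)
  have hTB := column_count_le_TB (γ := w.re) (r := 68) (by linarith) (by norm_num) le_rfl
  rw [div_xiSpacing] at hTB
  have e1 : w.re + boxHalfWidth + 1 / 2 = w.re + 68 := by rw [hB]; ring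
  have e2 : w.re - boxHalfWidth - 1 / 2 = w.re - 68 := by rw [hB]; ring
  rw [e1, e2] at hcol
  linarith

/-- (C) the numeric step, uniform above the Platt–Trudgian height: `(136/2π·log(x/2π) + 2 W₁(2x) + 1/100)/(2x − 67.5) ≤ 10⁻⁶`
for `x ≥ T_PT − 67.5` (all logs `≤ log 2x ≤ 4·(2x)^{1/4}`, and `(2x)^{1/4} ≥ 1000`). -/
theorem numeric_bound {x : ℝ} (hx : 3000175332732 ≤ x) :
    (2 * 68 / (2 * π) * Real.log (x / (2 * π)) + 2 * W₁ (2 * x) + 1 / 100) / (2 * x - 135 / 2) ≤ 1 / 10 ^ 6 := by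
  have hπ := Real.pi_gt_three
  have hπ0 := Real.pi_pos
  have hx0 : 0 < x := by linarith
  have h2x : (1 : ℝ) < 2 * x := by linarith
  have hLpos : 0 < Real.log (2 * x) := Real.log_pos h2x
  have hl1 : Real.log (x / (2 * π)) ≤ Real.log (2 * x) := by
    apply Real.log_le_log (by positivity)
    rw [div_le_iff₀ (by positivity)]
    nlinarith
  have hlpos : 0 ≤ Real.log (x / (2 * π)) :=
    Real.log_nonneg (by rw [le_div_iff₀ (by positivity)]; nlinarith [Real.pi_lt_four])
  have hl2 : Real.log (Real.log (2 * x)) ≤ Real.log (2 * x) := by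
    linarith [Real.log_le_sub_one_of_pos hLpos]
  -- the fourth root `s` of `2x`
  have hs0 : 0 ≤ Real.sqrt (Real.sqrt (2 * x)) := Real.sqrt_nonneg _
  have hs2 : Real.sqrt (Real.sqrt (2 * x)) ^ 2 = Real.sqrt (2 * x) := Real.sq_sqrt (Real.sqrt_nonneg _)
  have hs4 : Real.sqrt (Real.sqrt (2 * x)) ^ 4 = 2 * x := by
    rw [show Real.sqrt (Real.sqrt (2 * x)) ^ 4 = (Real.sqrt (Real.sqrt (2 * x)) ^ 2) ^ 2 by ring, hs2,
      Real.sq_sqrt (by linarith)]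
  set s := Real.sqrt (Real.sqrt (2 * x)) with hs
  have hLs : Real.log (2 * x) = 4 * Real.log s := by
    rw [hs, Real.log_sqrt (Real.sqrt_nonneg _), Real.log_sqrt (by linarith)]
    ring
  have hs1000 : 1000 ≤ s := by
    by_contra hc
    have hc' : s < 1000 := lt_of_not_ge hc
    have : s ^ 4 < 1000 ^ 4 := pow_lt_pow_left₀ hc' hs0 (by norm_num)
    rw [hs4] at this
    norm_num at this
    linarith
  have hspos : 0 < s := by linarith
  have hlogs : Real.log s ≤ s := by linarith [Real.log_le_sub_one_of_pos hspos]
  have hW : W₁ (2 * x) = 0.1035 * Real.log (2 * x) + 0.2395 * Real.log (Real.log (2 * x)) + 4.92 := rfl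
  have hA : 2 * 68 / (2 * π) * Real.log (x / (2 * π)) ≤ 23 * Real.log (2 * x) := by
    have hcoef : 2 * 68 / (2 * π) ≤ 23 := by
      rw [div_le_iff₀ (by positivity)]
      nlinarith
    have hcoef0 : 0 ≤ 2 * 68 / (2 * π) := by positivity
    nlinarith
  have h3 : (1000 : ℝ) ^ 3 ≤ s ^ 3 := pow_le_pow_left₀ (by norm_num) hs1000 3
  have h4 : 10 ^ 9 * s ≤ s ^ 4 := by nlinarith [h3, hspos]
  rw [div_le_iff₀ (by linarith), hW]
  linarith [hA, hl2, hLs, hlogs, h4, hs4, hs1000]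

/-- ★ (K) LEAF 3 with the explicit constant: `‖nearPartnerSum w‖ ≤ 10⁻⁶` on every box above the Platt–Trudgian height. -/
theorem norm_nearPartnerSum_le {γ : ℝ} {w : ℂ} (hγ : T_PT < γ) (hw : |w.re - γ| ≤ boxHalfWidth) :
    ‖nearPartnerSum w‖ ≤ 1 / 10 ^ 6 := by
  have hT : T_PT = 3000175332800 := rfl
  have hB : boxHalfWidth = 135 / 2 := rfl
  have hlo := (abs_le.1 hw).1
  have hx : 3000175332732 ≤ w.re := by rw [hT] at hγ; rw [hB] at hlo; linarith
  have hre : boxHalfWidth < w.re := by rw [hB]; linarith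
  have h1 := norm_nearPartnerSum_le_count hre
  have h2 := count_le (w := w) (by linarith)
  have h3 := numeric_bound hx
  rw [hB] at h1
  calc ‖nearPartnerSum w‖ ≤ (∑ᶠ u ∈ nearWin w, xiOrd u) / (2 * w.re - 135 / 2) := h1
    _ ≤ (2 * 68 / (2 * π) * Real.log (w.re / (2 * π)) + 2 * W₁ (2 * w.re) + 1 / 100) / (2 * w.re - 135 / 2) :=
        div_le_div_of_nonneg_right h2 (by linarith)
    _ ≤ 1 / 10 ^ 6 := h3

/-- ★ (K) **LEAF 3 CLOSED** for every constants table with `cN ≥ 10⁻⁶`. -/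
theorem nearPartnerLeaf_of (K : LeafConsts) (hK : 1 / 10 ^ 6 ≤ K.cN) : NearPartnerLeaf K :=
  fun _ hγ _ hw _ ↦ (norm_nearPartnerSum_le hγ hw).trans hK

/-- (K) LEAF 3 for C3 g41's recommended table `K4N = ⟨0.00518, 0.03105, 10⁻⁶, 10⁻⁶⟩` (`LedgerLeaf4 K4N` is C3's `ledgerLeaf4_K4N`). -/
theorem nearPartnerLeaf_K4N : NearPartnerLeaf ⟨518 / 100000, 3105 / 100000, 1 / 10 ^ 6, 1 / 10 ^ 6⟩ :=
  nearPartnerLeaf_of _ le_rfl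

end Summit.RiemannHypothesis.RiemannHypothesis.Theorems.EarlyAppointmentsRemainder0Xi.NearPartnerLeaf
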